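import Summits.AnomalousDissipation.AnomalousDissipation.Theorems.SawtoothPulseCascadeK1LocalisedCascadeCanonicalRatioSteps
import Summits.AnomalousDissipation.AnomalousDissipation.Theorems.SawtoothPulseCascadeK1LocalisedCascadeCanonicalBlocks
import Summits.AnomalousDissipation.AnomalousDissipation.Theorems.SawtoothPulseCascadeK1LocalisedCascadeRatioBlocksOsc
import Summits.AnomalousDissipation.AnomalousDissipation.Theorems.SawtoothPulseCascadeK1LocalisedCascadeBlockJunkOscGeom
import Summits.AnomalousDissipation.AnomalousDissipation.Theorems.SawtoothPulseCascadeK1LocalisedCascadeThinRatioBlocks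
import Summits.AnomalousDissipation.AnomalousDissipation.Theorems.SawtoothPulseCascadeK1LocalisedCascadeLedgerArith

/-!
# K1loc — helper: THE RATIO STEPS (O-V), (C-H) ON THE SLOW GEOMETRIC BLOCKS, OSCILLATORY GRADE (thin tail, uniform constants)

Helper file of the prover lane on the crux `K1LocalisedCascade` (stmt-AnomalousDissipation-19491), route `SawtoothPulseCascade`
(S-B/S-C assembly seat; the LEDGER ASSEMBLY, thin tail; companion of `…ThinStripStepsOsc`).  The ratio windows of `…RatioBlocksOsc`
(class `u|k₀| ≤ v|k₁|` resp. `u|k₁| ≤ v|k₀|`, margin `μ = uG − v`) over the slow geometric fibre family `Λ_m = ⌊Λ₀9^m/8^m⌋` of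
`…ThinRatioBlocks` (window tops `Q₂^m = ⌊θ_nμΛ_m/(θ_du)⌋`, feed cut-offs `Q₁^m = ⌊u′Λ_{m+1}/v′⌋`), canonical oscillatory depth, UNIFORM
constants `r* = (c_d + c_n)/(c_d − c_n)`, `A* = ((v + uG)θ_d + θ_nμ)/((θ_d − θ_n)μ)`, `D₀ = (θ_d − θ_n)μΛ₀/(2θ_du)`, `D_m ≥ D₀(9/8)^m`
(`…BlockJunkOscGeom.blockJunk_osc_sum_le_geom` at `ρ = 9/8`, `S = 9`):
  `J = 3r*²((4/3)(A*πGηΛ₀2^{M_b}/N)² + 9(2N/(πD₀))² + 9·4NA*/(πD₀) + M_b(8NA*²√(4Mδ/(πD₀)) + 8A*²Mδ/π))`.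
* `ratioClass_vstep_thinOsc_le` (O-V type): class `[X ≤ |k₀| ∧ u|k₀| ≤ v|k₁|]` of `a_{j+1}` (`vΛ₀ ≤ uX`) `≤ (√J + √feed)² + far`;
* `ratioClass_hstep_thinOsc_le` (C-H / B-H type): class `[Λ₀ ≤ |k₀| ∧ u|k₁| ≤ v|k₀|]` of `b_j` `≤ (√J + √feed)² + far`.
The separation and cut-off-fraction facts on every block come from FOUR scalar hypotheses (slope + base; `…ThinRatioBlocks.thinR_sep/_frac`).
No definitions; no statement about the crux. [cite: Grafakos2014, Prop. 3.1.2 (5), Prop. 3.2.7 (3), §3.1.3] [problem: turb]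
-/

-- `Summit.<Summit>.<Problem>`: single-conjunct summit, the duplicate namespace segment is deliberate.
set_option linter.dupNamespace false

noncomputable section

namespace Summit.AnomalousDissipation.AnomalousDissipation.Theorems.SawtoothPulseCascade.K1Window

open MeasureTheory Set Filter Topology UnitAddTorus Function Complex Metric
open scoped Real ENNReal
open Literature.Analysis Literature.Analysis.FunctionSpaces Literature.Analysis.FunctionSpaces.Torus Literature.Analysis.FluidPDE
open Literature.Analysis.FluidPDE.ShearStage
open Literature.Analysis.FluidPDE.SawtoothCascade Literature.Analysis.FluidPDE.SawtoothCascade.CascadeParams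
open Summit.AnomalousDissipation.AnomalousDissipation.Theorems.SawtoothPulseCascade.K1Start
open Summit.AnomalousDissipation.AnomalousDissipation.Theorems.SawtoothPulseCascade.K1Flat
open Summit.AnomalousDissipation.AnomalousDissipation.Theorems.SawtoothPulseCascade.K1Ledger.From

section Cascade

variable (P : CascadeParams)

set_option maxHeartbeats 800000 in
/-- **(O-V type) THE RATIO CLASS THROUGH THE V HALF-STEP ON THE SLOW GEOMETRIC BLOCKS, UNIFORM CONSTANTS** (see the file header).
Class `Σ'[X ≤ |k₀| ∧ u|k₀| ≤ v|k₁|]‖𝓕a_{j+1}‖²` (`0 < u`, `0 < v < uG`, `vΛ₀ ≤ uX`, `Λ₀ ≥ 2`), feed `Σ'[Y ≤ |k₀| ∧ u′|k₁| ≤ v′|k₀|]‖𝓕b_j‖²`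
(`v′ > 0`, `Y ≤ Q₁⁰ + 1`). [cite: Grafakos2014, Prop. 3.1.2 (5), Prop. 3.2.7 (3), §3.1.3] -/
theorem ratioClass_vstep_thinOsc_le {G : ℕ} (hγ : P.γ = G) (hδ₀ : 0 < P.δ₀) (hd : 0 < P.d) (hN₀ : 1 ≤ P.N₀)
    (hρN : 1 ≤ P.ρN) (a b : ℕ → UnitAddTorus (Fin 2) → ℝ) (has : ∀ j, IsSmooth (a j)) (h0 : a 0 = datum)
    (hb : ∀ j, b j = a j ∘ shearMap 0 1 (amp ⟨P.U j, P.U_periodic j, P.contDiff_U (P.δ_pos hδ₀ hd j)⟩ P.γ))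
    (hab : ∀ j, a (j + 1) = b j ∘ shearMap 1 0 (amp ⟨P.U j, P.U_periodic j, P.contDiff_U (P.δ_pos hδ₀ hd j)⟩ P.γ))
    (j : ℕ) {u v X u' v' Y θn θd cn cd Λ0 : ℕ} (hu : 0 < u) (hv : 0 < v) (hvu : v < u * G) (hθd : 0 < θd) (hθ : θn < θd)
    (hv' : 0 < v') (hcd : 0 < cd) (hc : cn < cd) (hΛ0 : 2 ≤ Λ0) (hΛX : v * Λ0 ≤ u * X)
    (hsl : 9 * θd * u * u' ≤ 8 * v' * θn * (u * G - v))
    (hba : θd * u * (9 * u' * Λ0 + 8 * u' + 8 * v') ≤ 8 * v' * θn * (u * G - v) * Λ0)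
    (hslf : 9 * θd * u * cd * u' ≤ 8 * cn * v' * θn * (u * G - v))
    (hbaf : θd * u * cd * u' * (9 * Λ0 + 8) + 8 * cn * v' * (θd * u) ≤ 8 * cn * v' * θn * (u * G - v) * Λ0)
    (hY : Y ≤ u' * (Λ0 * 9 ^ 1 / 8 ^ 1) / v' + 1)
    (Mb : ℕ) {η : ℝ} (hη : 0 < η) (hMδ : max 1 (Real.sqrt (2 * Real.log (1 / η))) * P.δ j < π / 2) :
    ∑' k : Fin 2 → ℤ, (if (X : ℤ) ≤ |k 0| ∧ (u : ℤ) * |k 0| ≤ (v : ℤ) * |k 1| then (1 : ℝ) else 0) *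
        ‖mFourierCoeff (fun x => (a (j + 1) x : ℂ)) k‖ ^ 2 ≤
      (Real.sqrt (3 * (((cd : ℝ) + cn) / ((cd : ℝ) - cn)) ^ 2 *
            (4 / 3 * (((((v : ℝ) + u * G) * θd + θn * ((u * G - v : ℕ) : ℝ)) / (((θd : ℝ) - θn) * ((u * G - v : ℕ) : ℝ))) *
                π * G * η * Λ0 / P.N j * 2 ^ Mb) ^ 2 +
              9 * (2 * P.N j / (π * (((θd : ℝ) - θn) * ((u * G - v : ℕ) : ℝ) * Λ0 / (2 * θd * u)))) ^ 2 +
              9 * (4 * P.N j * ((((v : ℝ) + u * G) * θd + θn * ((u * G - v : ℕ) : ℝ)) / (((θd : ℝ) - θn) * ((u * G - v : ℕ) : ℝ))) /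
                (π * (((θd : ℝ) - θn) * ((u * G - v : ℕ) : ℝ) * Λ0 / (2 * θd * u)))) +
              Mb * (8 * P.N j * ((((v : ℝ) + u * G) * θd + θn * ((u * G - v : ℕ) : ℝ)) / (((θd : ℝ) - θn) * ((u * G - v : ℕ) : ℝ))) ^ 2 *
                Real.sqrt (4 * (max 1 (Real.sqrt (2 * Real.log (1 / η))) * P.δ j) /
                  (π * (((θd : ℝ) - θn) * ((u * G - v : ℕ) : ℝ) * Λ0 / (2 * θd * u)))) +
                8 * ((((v : ℝ) + u * G) * θd + θn * ((u * G - v : ℕ) : ℝ)) / (((θd : ℝ) - θn) * ((u * G - v : ℕ) : ℝ))) ^ 2 *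
                  (max 1 (Real.sqrt (2 * Real.log (1 / η))) * P.δ j) / π))) +
          Real.sqrt (∑' k : Fin 2 → ℤ, (if (Y : ℤ) ≤ |k 0| ∧ (u' : ℤ) * |k 1| ≤ (v' : ℤ) * |k 0| then (1 : ℝ) else 0) *
            ‖mFourierCoeff (fun x => (b j x : ℂ)) k‖ ^ 2)) ^ 2 +
        ((1 + P.γ) ^ (2 * (j + 1)) / ((Λ0 * 9 ^ Mb / 8 ^ Mb : ℕ) : ℝ)) ^ 2 := by
  -- the thin ratio data
  set M : ℝ := max 1 (Real.sqrt (2 * Real.log (1 / η))) with hMdef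
  have hM : 1 ≤ M := (zoneDepth_facts hη).1
  have hMη : Real.exp (-(M ^ 2 / 2)) ≤ η := (zoneDepth_facts hη).2
  have hN : (0 : ℝ) < P.N j := by exact_mod_cast P.N_pos hN₀ hρN j
  have hδ : 0 < P.δ j := P.δ_pos hδ₀ hd j
  have hMδ0 : 0 < M * P.δ j := mul_pos (by linarith) hδ
  set Λb : ℕ → ℕ := fun m => Λ0 * 9 ^ m / 8 ^ m with hΛb
  set Q₁ : ℕ → ℕ := fun m => u' * Λb (m + 1) / v' with hQ₁
  set Q₂ : ℕ → ℕ := fun m => θn * ((u * G - v) * Λb m) / (θd * u) with hQ₂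
  set A : ℕ → ℝ := fun m => (((v : ℝ) + u * G) * Λb m + u * Q₂ m) / (((u : ℝ) * G - v) * Λb m - u * Q₂ m) with hA
  set Dm : ℕ → ℝ := fun m => (((u : ℝ) * G - v) * Λb m - u * Q₂ m) / u with hDm
  set As : ℝ := (((v : ℝ) + u * G) * θd + θn * ((u * G - v : ℕ) : ℝ)) / (((θd : ℝ) - θn) * ((u * G - v : ℕ) : ℝ)) with hAs
  set D₀ : ℝ := ((θd : ℝ) - θn) * ((u * G - v : ℕ) : ℝ) * Λ0 / (2 * θd * u) with hD₀
  set rs : ℝ := ((cd : ℝ) + cn) / ((cd : ℝ) - cn) with hrs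
  have hμ : 0 < u * G - v := Nat.sub_pos_of_lt hvu
  have hΛ0' : 1 ≤ Λ0 := le_trans (by norm_num) hΛ0
  -- block facts
  have hge : ∀ m, Λ0 ≤ Λb m := fun m => thinR_blocks_ge Λ0 m
  have hΛ1 : ∀ m, 1 ≤ Λb m := fun m => hΛ0'.trans (hge m)
  have hΛQ : ∀ m, u * Q₂ m < Λb m * (u * G - v) := fun m =>
    thinR_shift hθ (Nat.mul_pos (lt_of_lt_of_le (by norm_num) (hΛ1 m)) hμ)
  have hQ : ∀ m, Q₁ m < Q₂ m := fun m =>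
    thinR_sep hv' hθd hu (thinR_blocks_succ_le Λ0 m) (hge m) hsl hba
  have hfeed : ∀ m, u' * Λb (m + 1) ≤ v' * (Q₁ m + 1) := fun m => thin_feed u' hv' (Λb (m + 1))
  have hfrac : ∀ m, cd * (u' * Λb (m + 1)) ≤ cn * (v' * Q₂ m) := fun m =>
    thinR_frac hθd hu (thinR_blocks_succ_le Λ0 m) (hge m) hslf hbaf
  have hr : ∀ m, ((Q₁ m : ℝ) + Q₂ m) / ((Q₂ m : ℝ) - Q₁ m) ≤ rs := fun m => thin_r_le hv' hcd hc (hQ m) (hfrac m)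
  have hAfacts : ∀ m, 1 ≤ A m ∧ A m ≤ As := fun m => thinR_A_facts hu hθ hvu (hΛ1 m)
  have hApos : ∀ m, 0 < A m := fun m => lt_of_lt_of_le one_pos (hAfacts m).1
  have hur : (0 : ℝ) < u := by exact_mod_cast hu
  have hθdr : (0 : ℝ) < θd := by exact_mod_cast hθd
  have hθr : (θn : ℝ) < θd := by exact_mod_cast hθ
  have hμr : (0 : ℝ) < ((u * G - v : ℕ) : ℝ) := by exact_mod_cast hμ
  have hΛ0r : (2 : ℝ) ≤ Λ0 := by exact_mod_cast hΛ0
  have hD₀pos : 0 < D₀ := by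
    have : (0 : ℝ) < (θd : ℝ) - θn := by linarith
    positivity
  have hDge : ∀ m, D₀ * (9 / 8 : ℝ) ^ m ≤ Dm m := fun m => thinR_den_ge hu hθ hvu hΛ0 m
  have hDpos : ∀ m, 0 < Dm m := fun m => lt_of_lt_of_le (by positivity) (hDge m)
  set d₀ : ℕ → ℝ := fun m => 1 / (2 * π * A m * Dm m) + Real.sqrt (4 * (M * P.δ j) / (π * A m * Dm m)) +
    M * P.δ j / (π * P.N j) with hd₀
  have hdpos : ∀ m, 0 < d₀ m := fun m => by
    have := hApos m; have := hDpos m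
    positivity
  set ε₀ : ℕ → ℝ := fun m => A m * (2 * π * ((Λb (m + 1) * G : ℕ) : ℝ) * (Real.exp (-(M ^ 2 / 2)) / (2 * P.N j))) +
    2 * P.N j / (π * Dm m) with hε₀
  have hε0 : ∀ m, 0 ≤ ε₀ m := fun m => by
    have := (hApos m).le; have := hDpos m
    positivity
  have hAs0 : 0 ≤ As := (hApos 0).le.trans (hAfacts 0).2
  have hY' : ∀ m, Y ≤ Q₁ m + 1 := fun m =>
    hY.trans (Nat.add_le_add_right (thin_Q₁_mono u' v' (thinR_blocks_monotone Λ0) (Nat.zero_le m)) 1)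
  -- the multi-block step
  have hstep := tsum_ratioClass_vstep_blocks_osc_le P hγ hδ₀ hd hN₀ hρN a b has h0 hb hab j (X := X) hu hv hvu Λb
    (thinR_blocks_monotone Λ0) (hΛ1 0) Mb (by simpa [hΛb] using hΛX) Q₁ Q₂
    hQ hΛQ hM hMδ d₀ ε₀ hdpos
    (fun m => oscDepth_hMd (M := M) (δ := P.δ j) (hApos m) (hDpos m) hN)
    (fun m => oscDepth_hAd (hApos m) (hDpos m) hN hMδ0.le) hε0 (fun m => le_rfl) (u' := u') (v' := v') (Y := Y)
    hfeed hY'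
  -- the junk in closed form (`ρ = 9/8`, `S = 9`)
  have hS : ∑ m ∈ Finset.range Mb, (1 / (9 / 8 : ℝ)) ^ m ≤ 9 :=
    (sum_range_inv_pow_le_of_lt (by norm_num) Mb).trans (by norm_num)
  have hjunk := blockJunk_osc_sum_le_geom (r := fun m => ((Q₁ m : ℝ) + Q₂ m) / ((Q₂ m : ℝ) - Q₁ m)) (A := A) (D := Dm) (ε₀ := ε₀)
    (rs := rs) (As := As) (D₀ := D₀) (e₀ := As * π * G * η * Λ0 / P.N j) (b₀ := 2 * P.N j / (π * D₀)) (N := (P.N j : ℝ))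
    (Mδ := M * P.δ j) (ρ := 9 / 8) (S := 9) hN hMδ0.le hD₀pos (by norm_num)
    (fun m => canon_r_nonneg (hQ m)) hr (fun m => (hAfacts m).1) (fun m => (hAfacts m).2) hDge hε0
    (by positivity) (by positivity) (fun m => ?_) Mb hS
  · -- assemble
    have e2N : ((2 * P.N j : ℕ) : ℝ) = 2 * (P.N j : ℝ) := by push_cast; ring
    rw [e2N] at hstep
    exact le_sq_sqrt_add_mono hstep (hjunk.trans (le_of_eq rfl))
  · -- the rounding allowance on block `m`
    simp only [hε₀]
    have hA' := (hAfacts m).2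
    have hA0' := (hApos m).le
    have hΛle : ((Λb (m + 1) * G : ℕ) : ℝ) ≤ (Λ0 : ℝ) * 2 ^ (m + 1) * G := by
      have h1 : ((Λb (m + 1) : ℕ) : ℝ) ≤ (Λ0 : ℝ) * 2 ^ (m + 1) := thinR_blocks_le_two_pow Λ0 (m + 1)
      push_cast
      exact mul_le_mul_of_nonneg_right h1 (Nat.cast_nonneg _)
    have hb : 2 * P.N j / (π * Dm m) ≤ 2 * P.N j / (π * D₀) * (1 / (9 / 8 : ℝ)) ^ m := by
      have e : 2 * P.N j / (π * D₀) * (1 / (9 / 8 : ℝ)) ^ m = 2 * P.N j / (π * (D₀ * (9 / 8) ^ m)) := by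
        rw [one_div_pow]; field_simp
      rw [e]
      exact div_le_div_of_nonneg_left (by positivity) (by positivity) (mul_le_mul_of_nonneg_left (hDge m) Real.pi_pos.le)
    refine add_le_add ?_ hb
    calc A m * (2 * π * ((Λb (m + 1) * G : ℕ) : ℝ) * (Real.exp (-(M ^ 2 / 2)) / (2 * P.N j)))
        = A m * Real.exp (-(M ^ 2 / 2)) * (π / P.N j) * ((Λb (m + 1) * G : ℕ) : ℝ) := by
          field_simp
      _ ≤ As * η * (π / P.N j) * ((Λ0 : ℝ) * 2 ^ (m + 1) * G) :=
          mul_le_mul (mul_le_mul_of_nonneg_right (mul_le_mul hA' hMη (Real.exp_nonneg _) hAs0) (by positivity)) hΛle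
            (by positivity) (by positivity)
      _ = As * π * G * η * Λ0 / P.N j * 2 ^ (m + 1) := by ring


set_option maxHeartbeats 800000 in
/-- **(C-H / B-H type) THE RATIO CLASS THROUGH THE H HALF-STEP ON THE SLOW GEOMETRIC BLOCKS, UNIFORM CONSTANTS** (see the file header).
Class `Σ'[Λ₀ ≤ |k₀| ∧ u|k₁| ≤ v|k₀|]‖𝓕b_j‖²` (`0 < u`, `0 < v < uG`, the class threshold is the fibre floor `Λ₀ ≥ 2`), feed
`Σ'[Y ≤ |k₀| ∧ u′|k₀| ≤ v′|k₁|]‖𝓕a_j‖²` (`v′ > 0`, `Y ≤ Λ₀`). [cite: Grafakos2014, Prop. 3.1.2 (5), Prop. 3.2.7 (3), §3.1.3] -/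
theorem ratioClass_hstep_thinOsc_le {G : ℕ} (hγ : P.γ = G) (hδ₀ : 0 < P.δ₀) (hd : 0 < P.d) (hN₀ : 1 ≤ P.N₀)
    (hρN : 1 ≤ P.ρN) (a b : ℕ → UnitAddTorus (Fin 2) → ℝ) (has : ∀ j, IsSmooth (a j)) (h0 : a 0 = datum)
    (hb : ∀ j, b j = a j ∘ shearMap 0 1 (amp ⟨P.U j, P.U_periodic j, P.contDiff_U (P.δ_pos hδ₀ hd j)⟩ P.γ))
    (hab : ∀ j, a (j + 1) = b j ∘ shearMap 1 0 (amp ⟨P.U j, P.U_periodic j, P.contDiff_U (P.δ_pos hδ₀ hd j)⟩ P.γ))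
    (j : ℕ) {u v u' v' Y θn θd cn cd Λ0 : ℕ} (hu : 0 < u) (hv : 0 < v) (hvu : v < u * G) (hθd : 0 < θd) (hθ : θn < θd)
    (hv' : 0 < v') (hcd : 0 < cd) (hc : cn < cd) (hΛ0 : 2 ≤ Λ0)
    (hsl : 9 * θd * u * u' ≤ 8 * v' * θn * (u * G - v))
    (hba : θd * u * (9 * u' * Λ0 + 8 * u' + 8 * v') ≤ 8 * v' * θn * (u * G - v) * Λ0)
    (hslf : 9 * θd * u * cd * u' ≤ 8 * cn * v' * θn * (u * G - v))
    (hbaf : θd * u * cd * u' * (9 * Λ0 + 8) + 8 * cn * v' * (θd * u) ≤ 8 * cn * v' * θn * (u * G - v) * Λ0)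
    (hY : Y ≤ Λ0)
    (Mb : ℕ) {η : ℝ} (hη : 0 < η) (hMδ : max 1 (Real.sqrt (2 * Real.log (1 / η))) * P.δ j < π / 2) :
    ∑' k : Fin 2 → ℤ, (if (Λ0 : ℤ) ≤ |k 0| ∧ (u : ℤ) * |k 1| ≤ (v : ℤ) * |k 0| then (1 : ℝ) else 0) *
        ‖mFourierCoeff (fun x => (b j x : ℂ)) k‖ ^ 2 ≤
      (Real.sqrt (3 * (((cd : ℝ) + cn) / ((cd : ℝ) - cn)) ^ 2 *
            (4 / 3 * (((((v : ℝ) + u * G) * θd + θn * ((u * G - v : ℕ) : ℝ)) / (((θd : ℝ) - θn) * ((u * G - v : ℕ) : ℝ))) *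
                π * G * η * Λ0 / P.N j * 2 ^ Mb) ^ 2 +
              9 * (2 * P.N j / (π * (((θd : ℝ) - θn) * ((u * G - v : ℕ) : ℝ) * Λ0 / (2 * θd * u)))) ^ 2 +
              9 * (4 * P.N j * ((((v : ℝ) + u * G) * θd + θn * ((u * G - v : ℕ) : ℝ)) / (((θd : ℝ) - θn) * ((u * G - v : ℕ) : ℝ))) /
                (π * (((θd : ℝ) - θn) * ((u * G - v : ℕ) : ℝ) * Λ0 / (2 * θd * u)))) +
              Mb * (8 * P.N j * ((((v : ℝ) + u * G) * θd + θn * ((u * G - v : ℕ) : ℝ)) / (((θd : ℝ) - θn) * ((u * G - v : ℕ) : ℝ))) ^ 2 *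
                Real.sqrt (4 * (max 1 (Real.sqrt (2 * Real.log (1 / η))) * P.δ j) /
                  (π * (((θd : ℝ) - θn) * ((u * G - v : ℕ) : ℝ) * Λ0 / (2 * θd * u)))) +
                8 * ((((v : ℝ) + u * G) * θd + θn * ((u * G - v : ℕ) : ℝ)) / (((θd : ℝ) - θn) * ((u * G - v : ℕ) : ℝ))) ^ 2 *
                  (max 1 (Real.sqrt (2 * Real.log (1 / η))) * P.δ j) / π))) +
          Real.sqrt (∑' k : Fin 2 → ℤ, (if (Y : ℤ) ≤ |k 0| ∧ (u' : ℤ) * |k 0| ≤ (v' : ℤ) * |k 1| then (1 : ℝ) else 0) *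
            ‖mFourierCoeff (fun x => (a j x : ℂ)) k‖ ^ 2)) ^ 2 +
        ((1 + P.γ) ^ (2 * j) / ((Λ0 * 9 ^ Mb / 8 ^ Mb : ℕ) : ℝ)) ^ 2 := by
  -- the thin ratio data
  set M : ℝ := max 1 (Real.sqrt (2 * Real.log (1 / η))) with hMdef
  have hM : 1 ≤ M := (zoneDepth_facts hη).1
  have hMη : Real.exp (-(M ^ 2 / 2)) ≤ η := (zoneDepth_facts hη).2
  have hN : (0 : ℝ) < P.N j := by exact_mod_cast P.N_pos hN₀ hρN j
  have hδ : 0 < P.δ j := P.δ_pos hδ₀ hd j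
  have hMδ0 : 0 < M * P.δ j := mul_pos (by linarith) hδ
  set Λb : ℕ → ℕ := fun m => Λ0 * 9 ^ m / 8 ^ m with hΛb
  set Q₁ : ℕ → ℕ := fun m => u' * Λb (m + 1) / v' with hQ₁
  set Q₂ : ℕ → ℕ := fun m => θn * ((u * G - v) * Λb m) / (θd * u) with hQ₂
  set A : ℕ → ℝ := fun m => (((v : ℝ) + u * G) * Λb m + u * Q₂ m) / (((u : ℝ) * G - v) * Λb m - u * Q₂ m) with hA
  set Dm : ℕ → ℝ := fun m => (((u : ℝ) * G - v) * Λb m - u * Q₂ m) / u with hDm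
  set As : ℝ := (((v : ℝ) + u * G) * θd + θn * ((u * G - v : ℕ) : ℝ)) / (((θd : ℝ) - θn) * ((u * G - v : ℕ) : ℝ)) with hAs
  set D₀ : ℝ := ((θd : ℝ) - θn) * ((u * G - v : ℕ) : ℝ) * Λ0 / (2 * θd * u) with hD₀
  set rs : ℝ := ((cd : ℝ) + cn) / ((cd : ℝ) - cn) with hrs
  have hμ : 0 < u * G - v := Nat.sub_pos_of_lt hvu
  have hΛ0' : 1 ≤ Λ0 := le_trans (by norm_num) hΛ0
  -- block facts
  have hge : ∀ m, Λ0 ≤ Λb m := fun m => thinR_blocks_ge Λ0 m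
  have hΛ1 : ∀ m, 1 ≤ Λb m := fun m => hΛ0'.trans (hge m)
  have hΛQ : ∀ m, u * Q₂ m < Λb m * (u * G - v) := fun m =>
    thinR_shift hθ (Nat.mul_pos (lt_of_lt_of_le (by norm_num) (hΛ1 m)) hμ)
  have hQ : ∀ m, Q₁ m < Q₂ m := fun m =>
    thinR_sep hv' hθd hu (thinR_blocks_succ_le Λ0 m) (hge m) hsl hba
  have hfeed : ∀ m, u' * Λb (m + 1) ≤ v' * (Q₁ m + 1) := fun m => thin_feed u' hv' (Λb (m + 1))
  have hfrac : ∀ m, cd * (u' * Λb (m + 1)) ≤ cn * (v' * Q₂ m) := fun m =>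
    thinR_frac hθd hu (thinR_blocks_succ_le Λ0 m) (hge m) hslf hbaf
  have hr : ∀ m, ((Q₁ m : ℝ) + Q₂ m) / ((Q₂ m : ℝ) - Q₁ m) ≤ rs := fun m => thin_r_le hv' hcd hc (hQ m) (hfrac m)
  have hAfacts : ∀ m, 1 ≤ A m ∧ A m ≤ As := fun m => thinR_A_facts hu hθ hvu (hΛ1 m)
  have hApos : ∀ m, 0 < A m := fun m => lt_of_lt_of_le one_pos (hAfacts m).1
  have hur : (0 : ℝ) < u := by exact_mod_cast hu
  have hθdr : (0 : ℝ) < θd := by exact_mod_cast hθd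
  have hθr : (θn : ℝ) < θd := by exact_mod_cast hθ
  have hμr : (0 : ℝ) < ((u * G - v : ℕ) : ℝ) := by exact_mod_cast hμ
  have hΛ0r : (2 : ℝ) ≤ Λ0 := by exact_mod_cast hΛ0
  have hD₀pos : 0 < D₀ := by
    have : (0 : ℝ) < (θd : ℝ) - θn := by linarith
    positivity
  have hDge : ∀ m, D₀ * (9 / 8 : ℝ) ^ m ≤ Dm m := fun m => thinR_den_ge hu hθ hvu hΛ0 m
  have hDpos : ∀ m, 0 < Dm m := fun m => lt_of_lt_of_le (by positivity) (hDge m)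
  set d₀ : ℕ → ℝ := fun m => 1 / (2 * π * A m * Dm m) + Real.sqrt (4 * (M * P.δ j) / (π * A m * Dm m)) +
    M * P.δ j / (π * P.N j) with hd₀
  have hdpos : ∀ m, 0 < d₀ m := fun m => by
    have := hApos m; have := hDpos m
    positivity
  set ε₀ : ℕ → ℝ := fun m => A m * (2 * π * ((Λb (m + 1) * G : ℕ) : ℝ) * (Real.exp (-(M ^ 2 / 2)) / (2 * P.N j))) +
    2 * P.N j / (π * Dm m) with hε₀
  have hε0 : ∀ m, 0 ≤ ε₀ m := fun m => by
    have := (hApos m).le; have := hDpos m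
    positivity
  have hAs0 : 0 ≤ As := (hApos 0).le.trans (hAfacts 0).2
  have e0 : Λb 0 = Λ0 := by simp [hΛb]
  -- the multi-block step
  have hstep := tsum_ratioClass_hstep_blocks_osc_le P hγ hδ₀ hd hN₀ hρN a b has h0 hb hab j hu hv hvu Λb
    (thinR_blocks_monotone Λ0) (hΛ1 0) Mb Q₁ Q₂
    hQ hΛQ hM hMδ d₀ ε₀ hdpos
    (fun m => oscDepth_hMd (M := M) (δ := P.δ j) (hApos m) (hDpos m) hN)
    (fun m => oscDepth_hAd (hApos m) (hDpos m) hN hMδ0.le) hε0 (fun m => le_rfl) (u' := u') (v' := v') (Y := Y)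
    hfeed (by rw [e0]; exact hY)
  rw [e0] at hstep
  -- the junk in closed form (`ρ = 9/8`, `S = 9`)
  have hS : ∑ m ∈ Finset.range Mb, (1 / (9 / 8 : ℝ)) ^ m ≤ 9 :=
    (sum_range_inv_pow_le_of_lt (by norm_num) Mb).trans (by norm_num)
  have hjunk := blockJunk_osc_sum_le_geom (r := fun m => ((Q₁ m : ℝ) + Q₂ m) / ((Q₂ m : ℝ) - Q₁ m)) (A := A) (D := Dm) (ε₀ := ε₀)
    (rs := rs) (As := As) (D₀ := D₀) (e₀ := As * π * G * η * Λ0 / P.N j) (b₀ := 2 * P.N j / (π * D₀)) (N := (P.N j : ℝ))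
    (Mδ := M * P.δ j) (ρ := 9 / 8) (S := 9) hN hMδ0.le hD₀pos (by norm_num)
    (fun m => canon_r_nonneg (hQ m)) hr (fun m => (hAfacts m).1) (fun m => (hAfacts m).2) hDge hε0
    (by positivity) (by positivity) (fun m => ?_) Mb hS
  · -- assemble
    have e2N : ((2 * P.N j : ℕ) : ℝ) = 2 * (P.N j : ℝ) := by push_cast; ring
    rw [e2N] at hstep
    exact le_sq_sqrt_add_mono hstep (hjunk.trans (le_of_eq rfl))
  · -- the rounding allowance on block `m`
    simp only [hε₀]
    have hA' := (hAfacts m).2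
    have hA0' := (hApos m).le
    have hΛle : ((Λb (m + 1) * G : ℕ) : ℝ) ≤ (Λ0 : ℝ) * 2 ^ (m + 1) * G := by
      have h1 : ((Λb (m + 1) : ℕ) : ℝ) ≤ (Λ0 : ℝ) * 2 ^ (m + 1) := thinR_blocks_le_two_pow Λ0 (m + 1)
      push_cast
      exact mul_le_mul_of_nonneg_right h1 (Nat.cast_nonneg _)
    have hb : 2 * P.N j / (π * Dm m) ≤ 2 * P.N j / (π * D₀) * (1 / (9 / 8 : ℝ)) ^ m := by
      have e : 2 * P.N j / (π * D₀) * (1 / (9 / 8 : ℝ)) ^ m = 2 * P.N j / (π * (D₀ * (9 / 8) ^ m)) := by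
        rw [one_div_pow]; field_simp
      rw [e]
      exact div_le_div_of_nonneg_left (by positivity) (by positivity) (mul_le_mul_of_nonneg_left (hDge m) Real.pi_pos.le)
    refine add_le_add ?_ hb
    calc A m * (2 * π * ((Λb (m + 1) * G : ℕ) : ℝ) * (Real.exp (-(M ^ 2 / 2)) / (2 * P.N j)))
        = A m * Real.exp (-(M ^ 2 / 2)) * (π / P.N j) * ((Λb (m + 1) * G : ℕ) : ℝ) := by
          field_simp
      _ ≤ As * η * (π / P.N j) * ((Λ0 : ℝ) * 2 ^ (m + 1) * G) :=
          mul_le_mul (mul_le_mul_of_nonneg_right (mul_le_mul hA' hMη (Real.exp_nonneg _) hAs0) (by positivity)) hΛle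
            (by positivity) (by positivity)
      _ = As * π * G * η * Λ0 / P.N j * 2 ^ (m + 1) := by ring

end Cascade

end Summit.AnomalousDissipation.AnomalousDissipation.Theorems.SawtoothPulseCascade.K1Window
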